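import Mathlib
import Literature.NumberTheory.Automorphic.HilbertModularFormQExpansion
import Summits.Langlands.Langlands.Theorems.CapacityClassicalityHilbertIntegralOverconvergentIsCongruenceStubLeadConvolution

/-!
# Leading coefficient of a bracket-type cone convolution (stub stub_bracket_lead_coeff of line Sketch-ideate-r1-k1)

Stub `stub_bracket_lead_coeff` (X4) for line Sketch-ideate-r1-k1 of the crux
`HilbertIntegralOverconvergentIsCongruence` (stmt-Langlands-8485).  Section X of the line builds
Hilbert modular forms of non-parallel weight from Rankin–Cohen brackets, and needs the leading
coefficient of the bracket-type convolution
`c ν = ∑_{(μ, μ') cone pair, μ + μ' = ν} (a μ · b' μ' - b μ · a' μ')`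
of coefficient functions `a, b` supported on the `q`-expansion cone `qIndexSet F` and "derived"
coefficient functions `a', b'` (`supp a' ⊆ supp a`, `supp b' ⊆` cone, `b' 0 = 0`), for a real
height `lam : F →+ ℝ` (additive, injective, positive on the non-zero cone indices).  At a
`lam`-minimal point `νa` of the support of `a` one has `c νa = -(b 0 · a' νa)`.

Proof.  List the (finite) antidiagonal of `νa` by the landed `lcv_exists_antidiagonal_finset` and
split the sum.  In `∑ a μ · b' μ'` a contributing pair has `a μ ≠ 0` and `b' μ' ≠ 0`, so
`lam νa ≤ lam μ` and `lam μ + lam μ' = lam νa` give `lam μ' ≤ 0`; as `μ'` lies in the cone this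
forces `μ' = 0`, killed by `b' 0 = 0`: the first sum vanishes.  In `∑ b μ · a' μ'` a contributing
pair has `a' μ' ≠ 0`, hence `a μ' ≠ 0` and `lam νa ≤ lam μ'`, while `lam μ ≥ 0` as `μ` lies in the
cone; so `lam μ' = lam νa`, `μ' = νa` by injectivity and `μ = 0` by cancellation.  The pair
`(0, νa)` does lie on the antidiagonal, so the second sum is `b 0 · a' νa`.  (The hypothesis
`a 0 = 0` of the registered signature is not needed.)
-/

set_option linter.dupNamespace false

noncomputable section

namespace Summit.Langlands.Langlands.Theorems.HilbertIntegralOverconvergentIsCongruence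

open MeasureTheory Complex NumberField
open Literature.NumberTheory.Automorphic Literature.NumberTheory.Automorphic.HilbertModular
open scoped MatrixGroups

/-- A cone index has non-negative height, when the height `lam` is positive on the non-zero cone
indices. [folklore] -/
theorem blc_height_nonneg {F : Type} [Field F] [NumberField F] (lam : F →+ ℝ)
    (hpos : ∀ ν ∈ qIndexSet F, ν ≠ 0 → 0 < lam ν) {μ : F} (hμ : μ ∈ qIndexSet F) :
    0 ≤ lam μ := by
  by_cases hμ0 : μ = 0
  · rw [hμ0, map_zero]
  · exact (hpos μ hμ hμ0).le

/-- A cone index of non-positive height is `0`, when the height `lam` is positive on the non-zero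
cone indices. [folklore] -/
theorem blc_eq_zero_of_height_nonpos {F : Type} [Field F] [NumberField F] (lam : F →+ ℝ)
    (hpos : ∀ ν ∈ qIndexSet F, ν ≠ 0 → 0 < lam ν) {μ : F} (hμ : μ ∈ qIndexSet F)
    (hle : lam μ ≤ 0) : μ = 0 := by
  by_contra hne
  exact absurd (hpos μ hμ hne) (not_lt.2 hle)

/-- First half of the bracket convolution at a `lam`-minimal point `νa` of `supp a`: every pair
`(μ, μ')` with `μ + μ' = νa` has `a μ · b' μ' = 0`, when `supp b'` lies in the cone and `b' 0 = 0`
(if `a μ ≠ 0` and `b' μ' ≠ 0` then `lam νa ≤ lam μ`, so `lam μ' ≤ 0` and `μ' = 0`). [folklore] -/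
theorem blc_fst_term_eq_zero {F : Type} [Field F] [NumberField F] (lam : F →+ ℝ)
    (hpos : ∀ ν ∈ qIndexSet F, ν ≠ 0 → 0 < lam ν) (a b' : F → ℂ)
    (hb' : ∀ ν, b' ν ≠ 0 → ν ∈ qIndexSet F) (hb'0 : b' 0 = 0) (νa : F)
    (hmina : ∀ ν, a ν ≠ 0 → lam νa ≤ lam ν) {μ μ' : F} (hsum : μ + μ' = νa) :
    a μ * b' μ' = 0 := by
  by_contra hne
  obtain ⟨haμ, hb'μ'⟩ := mul_ne_zero_iff.1 hne
  have h1 : lam νa ≤ lam μ := hmina μ haμ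
  have h2 : lam μ + lam μ' = lam νa := by rw [← map_add, hsum]
  have h3 : lam μ' ≤ 0 := by linarith
  have h4 : μ' = 0 := blc_eq_zero_of_height_nonpos lam hpos (hb' μ' hb'μ') h3
  rw [h4, hb'0] at hb'μ'
  exact hb'μ' rfl

/-- Second half of the bracket convolution at a `lam`-minimal point `νa` of `supp a`, for an
INJECTIVE height `lam`: a pair `(μ, μ')` with `μ + μ' = νa` and `b μ · a' μ' ≠ 0` (where `supp b`
lies in the cone and `supp a' ⊆ supp a`) is the pair `(0, νa)` (`a μ' ≠ 0` gives
`lam νa ≤ lam μ'`, and `lam μ ≥ 0`, so `lam μ' = lam νa`, `μ' = νa` by injectivity, and `μ = 0` by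
cancellation). [folklore] -/
theorem blc_snd_pair_eq {F : Type} [Field F] [NumberField F] (lam : F →+ ℝ)
    (hlam : Function.Injective lam) (hpos : ∀ ν ∈ qIndexSet F, ν ≠ 0 → 0 < lam ν)
    (a b a' : F → ℂ) (hb : ∀ ν, b ν ≠ 0 → ν ∈ qIndexSet F) (ha' : ∀ ν, a' ν ≠ 0 → a ν ≠ 0)
    (νa : F) (hmina : ∀ ν, a ν ≠ 0 → lam νa ≤ lam ν) {μ μ' : F} (hsum : μ + μ' = νa)
    (hne : b μ * a' μ' ≠ 0) : (μ, μ') = (0, νa) := by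
  obtain ⟨hbμ, ha'μ'⟩ := mul_ne_zero_iff.1 hne
  have h0 : 0 ≤ lam μ := blc_height_nonneg lam hpos (hb μ hbμ)
  have h1 : lam νa ≤ lam μ' := hmina μ' (ha' μ' ha'μ')
  have h2 : lam μ + lam μ' = lam νa := by rw [← map_add, hsum]
  have h3 : lam μ' = lam νa := by linarith
  have h4 : μ' = νa := hlam h3
  subst h4
  exact Prod.ext (add_eq_right.1 hsum) rfl

set_option linter.unusedVariables false in -- registered signature: `ha0 : a 0 = 0` is not needed for this identity and deliberately unused
/-- **stub X4 — `stub_bracket_lead_coeff` (M; the leading coefficient of a bracket-type convolution).** For an injective additive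
height `λ` positive on the non-zero cone indices, coefficient functions `a, b` supported on the cone with `a(0) = 0`, "derived"
coefficient functions `a', b'` with `supp a' ⊆ supp a`, `supp b' ⊆` cone and `b'(0) = 0`, and `c(ν) = ∑_{μ+μ'=ν} (a_μ b'_μ' - b_μ a'_μ')`
over cone pairs: at a `λ`-minimal index `νa` of `supp a` one has `c(νa) = -b(0) a'(νa)` (in `∑ a_μ b'_μ'` a contributing pair has
`λ(μ) ≥ λ(νa)`, so `λ(μ') ≤ 0`, `μ' = 0`, killed by `b'(0) = 0`; in `∑ b_μ a'_μ'` it has `λ(μ') ≥ λ(νa)`, so `μ = 0`, `μ' = νa`). [folklore] -/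
theorem stub_bracket_lead_coeff (F : Type) [Field F] [NumberField F] [NumberField.IsTotallyReal F]
    (lam : F →+ ℝ) (hlam : Function.Injective lam) (hpos : ∀ ν ∈ qIndexSet F, ν ≠ 0 → 0 < lam ν)
    (a b a' b' c : F → ℂ) (ha : ∀ ν, a ν ≠ 0 → ν ∈ qIndexSet F) (hb : ∀ ν, b ν ≠ 0 → ν ∈ qIndexSet F)
    (ha0 : a 0 = 0) (ha' : ∀ ν, a' ν ≠ 0 → a ν ≠ 0) (hb' : ∀ ν, b' ν ≠ 0 → ν ∈ qIndexSet F) (hb'0 : b' 0 = 0)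
    (hc : ∀ (ν : F) (T : Finset (F × F)),
      (∀ μ : F × F, μ ∈ T ↔ μ.1 ∈ qIndexSet F ∧ μ.2 ∈ qIndexSet F ∧ μ.1 + μ.2 = ν) →
      c ν = ∑ μ ∈ T, (a μ.1 * b' μ.2 - b μ.1 * a' μ.2))
    (νa : F) (hνa : a νa ≠ 0) (hmina : ∀ ν, a ν ≠ 0 → lam νa ≤ lam ν) :
    c νa = -(b 0 * a' νa) := by
  obtain ⟨T, hT⟩ := lcv_exists_antidiagonal_finset F νa
  rw [hc νa T hT, Finset.sum_sub_distrib]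
  -- the first sum vanishes termwise
  have hfst : ∑ μ ∈ T, a μ.1 * b' μ.2 = 0 := by
    refine Finset.sum_eq_zero ?_
    rintro ⟨μ, μ'⟩ hμT
    exact blc_fst_term_eq_zero lam hpos a b' hb' hb'0 νa hmina ((hT _).1 hμT).2.2
  -- in the second sum only the pair `(0, νa)` contributes
  have hsnd : ∑ μ ∈ T, b μ.1 * a' μ.2 = b 0 * a' νa := by
    refine Finset.sum_eq_single (0, νa) ?_ fun h ↦
      absurd ((hT _).2 ⟨zero_mem_qIndexSet, ha νa hνa, zero_add νa⟩) h
    rintro ⟨μ, μ'⟩ hμT hne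
    by_contra h
    exact hne (blc_snd_pair_eq lam hlam hpos a b a' hb ha' νa hmina ((hT _).1 hμT).2.2 h)
  rw [hfst, hsnd, zero_sub]

end Summit.Langlands.Langlands.Theorems.HilbertIntegralOverconvergentIsCongruence

end
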